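import Literature.AlgebraicGeometry.Motives.GrassmannianGLPoints
import HarnessLib

/-!
# Split surjections of free modules acting on the points of the Grassmannian functor: `N ↦ S⁻¹N` and its inverse `N ↦ S N`

Topic `AlgebraicGeometry/Motives`; namespace `Literature.AlgebraicGeometry.Motives.Grassmannian`. DEFINITIONS with bodies (`matLinMap`,
`splitPrecomp`, `splitPostcomp`) and theorems; no instance, no notation, no named fact, no `sorry`.

[GortzWedhorn2020, Prop. 8.17 (2)]: a surjection `v : ℰ₁ ↠ ℰ₂` induces a closed immersion `Grass^e(ℰ₂) ↪ Grass^e(ℰ₁)`, a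
quotient of `ℰ₂` being composed with `v`. The tree has the ring side for surjections DEFINED OVER THE BASE (`Motives/GrassmannianPrecomp`,
`precomp (u ⊗ 1)`) and for invertible square matrices with coefficients in `A` (`Motives/GrassmannianGLPoints`, `glSmul`). This file
treats the case needed for the local triviality of projective bundles (`Motives/ProjectiveBundleOfQuotient*`): a RECTANGULAR
matrix `S ∈ M_{m×n}(A)` with a right inverse `R ∈ M_{n×m}(A)` (`S R = 1`) — a SPLIT surjection `A ⊗ M ↠ A ⊗ M'` of free modules
with bases `b : n → M`, `b' : m → M'` — with coefficients in the ring `A` of `A`-points (so NOT a base change of a fixed surjection):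

* §1 `matLinMap b b' S : A ⊗_R M →ₗ[A] A ⊗_R M'` (the matrix acting through the bases `1 ⊗ b`, `1 ⊗ b'`; ★ `tensorCoord`),
  `matLinMap_mul`, `matLinMap_one`, naturality `rTensor_matLinMap_one_tmul`, and `matLinMap_surjective_of_mul_eq_one`;
* §2 **`splitPrecomp`** `N ↦ S⁻¹N : G(k, A ⊗ M'; A) → G(k, A ⊗ M; A)` (★ `precomp`), injective, natural in the ring
  (`map_splitPrecomp`, ★ `map_precomp_of_sq`), with `ker S ≤ S⁻¹N` (`ker_matLinMap_le_splitPrecomp`);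
* §3 **`splitPostcomp`** `N ↦ S N` for `N ⊇ ker S` — the INVERSE on the image: `(A ⊗ M)⧸N ≅ (A ⊗ M')⧸S N`
  (`splitPrecomp_splitPostcomp : S⁻¹(S N) = N`, `splitPostcomp_splitPrecomp : S(S⁻¹N') = N'`), so that
  **`exists_eq_splitPrecomp_iff`**: `N` is of the form `S⁻¹N'` iff `ker S ≤ N` — the image of `Grass(ℰ₂) ↪ Grass(ℰ₁)` on `A`-points.

## References
* [GortzWedhorn2020] U. Görtz, T. Wedhorn, *Algebraic Geometry I*, 2nd ed. (2020), Prop. 8.17 (2), (8.4) (pp. 213–215).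
* [StacksProject] The Stacks project, Tag 089R (Grassmannian functor, functoriality).
-/

set_option autoImplicit false

noncomputable section

universe u v v' w

open TensorProduct Function Matrix

namespace Literature.AlgebraicGeometry.Motives

namespace Grassmannian

variable {R : Type u} [CommRing R] {M : Type v} [AddCommGroup M] [Module R M] {M' : Type v'} [AddCommGroup M'] [Module R M']
  {n m : Type*} [Fintype n] [Fintype m] (b : Module.Basis n R M) (b' : Module.Basis m R M') {k : ℕ}
variable {A : Type w} [CommRing A] [Algebra R A] {B : Type w} [CommRing B] [Algebra R B]

/-! ## §1 Rectangular matrices acting between `A ⊗_R M` and `A ⊗_R M'` through the bases -/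

/-- **The matrix `S ∈ M_{m×n}(A)` as an `A`-linear map `A ⊗_R M → A ⊗_R M'`** through the bases `1 ⊗ b`, `1 ⊗ b'`:
`tensorCoord_{b'}⁻¹ ∘ (S *ᵥ ·) ∘ tensorCoord_b`. [cite: GortzWedhorn2020, Prop. 8.17 (2)] -/
def matLinMap (S : Matrix m n A) : A ⊗[R] M →ₗ[A] A ⊗[R] M' :=
  (tensorCoord b' A).symm.toLinearMap ∘ₗ Matrix.mulVecLin S ∘ₗ (tensorCoord b A).toLinearMap

/-- Unfolding. [cite: GortzWedhorn2020, Prop. 8.17 (2)] -/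
theorem matLinMap_apply (S : Matrix m n A) (x : A ⊗[R] M) :
    matLinMap b b' S x = (tensorCoord b' A).symm (S *ᵥ tensorCoord b A x) :=
  rfl

/-- `matLinMap (S * T) = matLinMap S ∘ matLinMap T`. [cite: GortzWedhorn2020, Prop. 8.17 (2)] -/
theorem matLinMap_mul {M'' : Type*} [AddCommGroup M''] [Module R M''] {l : Type*} [Fintype l] (b'' : Module.Basis l R M'')
    (S : Matrix l m A) (T : Matrix m n A) :
    matLinMap b b'' (S * T) = matLinMap b' b'' S ∘ₗ matLinMap b b' T := by
  refine LinearMap.ext fun x => ?_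
  rw [LinearMap.comp_apply, matLinMap_apply, matLinMap_apply, matLinMap_apply, LinearEquiv.apply_symm_apply,
    Matrix.mulVec_mulVec]

/-- `matLinMap 1 = id`. [cite: GortzWedhorn2020, Prop. 8.17 (2)] -/
@[simp]
theorem matLinMap_one [DecidableEq n] : matLinMap b b (1 : Matrix n n A) = LinearMap.id := by
  refine LinearMap.ext fun x => ?_
  rw [matLinMap_apply, Matrix.one_mulVec, LinearEquiv.symm_apply_apply, LinearMap.id_apply]

/-- **A matrix with a right inverse acts surjectively**: `S R = 1 ⟹ matLinMap S` surjective. [cite: GortzWedhorn2020, Prop. 8.17 (2)] -/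
theorem matLinMap_surjective_of_mul_eq_one [DecidableEq m] {S : Matrix m n A} {T : Matrix n m A} (h : S * T = 1) :
    Surjective (matLinMap b b' S) := fun y =>
  ⟨matLinMap b' b T y, by rw [← LinearMap.comp_apply, ← matLinMap_mul, h, matLinMap_one, LinearMap.id_apply]⟩

/-- **Naturality of the matrix action on `1 ⊗ x`**: for an `R`-algebra map `f : A → B`,
`(f ⊗ 1)(matLinMap_A S (1 ⊗ x)) = matLinMap_B (f S) (1 ⊗ x)`. [cite: GortzWedhorn2020, Prop. 8.17 (2)] -/
theorem rTensor_matLinMap_one_tmul (f : A →ₐ[R] B) (S : Matrix m n A) (x : M) :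
    LinearMap.rTensor M' f.toLinearMap (matLinMap b b' S ((1 : A) ⊗ₜ[R] x)) =
      matLinMap b b' (S.map f) ((1 : B) ⊗ₜ[R] x) := by
  rw [matLinMap_apply, matLinMap_apply, tensorCoord_one_tmul, tensorCoord_one_tmul, tensorCoord_symm_apply,
    tensorCoord_symm_apply, map_sum]
  refine Finset.sum_congr rfl fun i _ => ?_
  have h := RingHom.map_mulVec (f : A →+* B) S (fun j => algebraMap R A (b.repr x j)) i
  have hc : (⇑(f : A →+* B) ∘ fun j => algebraMap R A (b.repr x j)) = fun j => algebraMap R B (b.repr x j) :=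
    funext fun j => f.commutes _
  rw [hc] at h
  rw [TensorProduct.smul_tmul', TensorProduct.smul_tmul', smul_eq_mul, smul_eq_mul, mul_one, mul_one,
    LinearMap.rTensor_tmul, AlgHom.toLinearMap_apply, ← AlgHom.coe_toRingHom, h]

/-! ## §2 Precomposition with a split surjection: `N ↦ S⁻¹N` -/

section Split

variable [DecidableEq m] (S : Matrix m n A) (T : Matrix n m A) (hST : S * T = 1)

/-- **`S⁻¹N ∈ G(k, A ⊗ M; A)` for `N ∈ G(k, A ⊗ M'; A)`** and a split surjection `S` (`S T = 1`): the quotient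
`A ⊗ M ↠ A ⊗ M' ↠ Q_N` (★ `precomp`). [cite: GortzWedhorn2020, Prop. 8.17 (2)] [cite: StacksProject, Tag 089R] -/
def splitPrecomp (N : Module.Grassmannian A (A ⊗[R] M') k) : Module.Grassmannian A (A ⊗[R] M) k :=
  precomp (matLinMap b b' S) (matLinMap_surjective_of_mul_eq_one b b' hST) N

/-- The submodule of `S⁻¹N` is the preimage. [cite: GortzWedhorn2020, Prop. 8.17 (2)] -/
theorem splitPrecomp_toSubmodule (N : Module.Grassmannian A (A ⊗[R] M') k) :
    (splitPrecomp b b' S T hST N).toSubmodule = N.toSubmodule.comap (matLinMap b b' S) :=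
  rfl

/-- `N ↦ S⁻¹N` is injective. [cite: GortzWedhorn2020, Prop. 8.17 (2)] -/
theorem splitPrecomp_injective : Injective (splitPrecomp (k := k) b b' S T hST) :=
  precomp_injective _ (matLinMap_surjective_of_mul_eq_one b b' hST)

/-- **`ker S ≤ S⁻¹N`**. [cite: GortzWedhorn2020, Prop. 8.17 (2)] -/
theorem ker_matLinMap_le_splitPrecomp (N : Module.Grassmannian A (A ⊗[R] M') k) :
    LinearMap.ker (matLinMap b b' S) ≤ (splitPrecomp b b' S T hST N).toSubmodule := by
  rw [splitPrecomp_toSubmodule]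
  exact Submodule.comap_mono bot_le

omit hST in
/-- **NATURALITY IN THE RING**: for `f : A → B`, `map f (S⁻¹N) = (f S)⁻¹ (map f N)` (★ `map_precomp_of_sq` with the square
`(f ⊗ 1) ∘ S_A = S_B ∘ (f ⊗ 1)` on `1 ⊗ x`). [cite: GortzWedhorn2020, Prop. 8.17 (2)] [cite: StacksProject, Tag 089R] -/
theorem map_splitPrecomp (f : A →ₐ[R] B) (hST : S * T = 1) (hST' : S.map f * T.map f = 1)
    (N : Module.Grassmannian A (A ⊗[R] M') k) :
    Module.Grassmannian.map f (splitPrecomp b b' S T hST N) =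
      splitPrecomp b b' (S.map f) (T.map f) hST' (Module.Grassmannian.map f N) :=
  map_precomp_of_sq f _ _ _ _ (fun x => (rTensor_matLinMap_one_tmul b b' f S x).symm) N

omit [Fintype m] hST in
/-- The right-inverse relation is preserved by ring maps: `f(S) f(T) = 1`. [cite: GortzWedhorn2020, Prop. 8.17 (2)] -/
theorem map_mul_map_eq_one (f : A →+* B) (hST : S * T = 1) : S.map f * T.map f = 1 := by
  rw [← Matrix.map_mul, hST, Matrix.map_one _ (map_zero f) (map_one f)]

/-! ## §3 The inverse on the image: `N ↦ S N` for `N ⊇ ker S` -/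

omit [DecidableEq m] in
/-- For `N ⊇ ker S`, the quotient map `A ⊗ M → (A ⊗ M')⧸S N` has kernel `N`, so `(A ⊗ M)⧸N ≅ (A ⊗ M')⧸S N`.
[cite: GortzWedhorn2020, Prop. 8.17 (2)] -/
theorem comap_map_eq_of_ker_le (N : Submodule A (A ⊗[R] M)) (hN : LinearMap.ker (matLinMap b b' S) ≤ N) :
    (N.map (matLinMap b b' S)).comap (matLinMap b b' S) = N := by
  rw [Submodule.comap_map_eq, sup_eq_left.mpr hN]

/-- **`S N ∈ G(k, A ⊗ M'; A)` for `N ∈ G(k, A ⊗ M; A)` with `ker S ≤ N`**: the quotient `(A ⊗ M')⧸S N ≅ (A ⊗ M)⧸N` is finite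
projective of rank `k`. [cite: GortzWedhorn2020, Prop. 8.17 (2)] [cite: StacksProject, Tag 089R] -/
def splitPostcomp (N : Module.Grassmannian A (A ⊗[R] M) k) (hN : LinearMap.ker (matLinMap b b' S) ≤ N.toSubmodule) :
    Module.Grassmannian A (A ⊗[R] M') k :=
  haveI e : ((A ⊗[R] M) ⧸ N.toSubmodule) ≃ₗ[A] (A ⊗[R] M') ⧸ N.toSubmodule.map (matLinMap b b' S) :=
    (Submodule.quotEquivOfEq _ _ (by
        rw [LinearMap.ker_comp, Submodule.ker_mkQ, comap_map_eq_of_ker_le b b' S N.toSubmodule hN])).trans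
      (((N.toSubmodule.map (matLinMap b b' S)).mkQ ∘ₗ matLinMap b b' S).quotKerEquivOfSurjective
        ((Submodule.mkQ_surjective _).comp (matLinMap_surjective_of_mul_eq_one b b' hST)))
  { toSubmodule := N.toSubmodule.map (matLinMap b b' S)
    finite_quotient := Module.Finite.equiv e
    projective_quotient := Module.Projective.of_equiv e
    rankAtStalk_eq := fun p => by
      rw [← Module.rankAtStalk_eq_of_equiv e]
      exact N.rankAtStalk_eq p }

/-- The submodule of `S N` is the image. [cite: GortzWedhorn2020, Prop. 8.17 (2)] -/
theorem splitPostcomp_toSubmodule (N : Module.Grassmannian A (A ⊗[R] M) k)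
    (hN : LinearMap.ker (matLinMap b b' S) ≤ N.toSubmodule) :
    (splitPostcomp b b' S T hST N hN).toSubmodule = N.toSubmodule.map (matLinMap b b' S) :=
  rfl

/-- **`S⁻¹(S N) = N`** for `N ⊇ ker S`. [cite: GortzWedhorn2020, Prop. 8.17 (2)] -/
theorem splitPrecomp_splitPostcomp (N : Module.Grassmannian A (A ⊗[R] M) k)
    (hN : LinearMap.ker (matLinMap b b' S) ≤ N.toSubmodule) :
    splitPrecomp b b' S T hST (splitPostcomp b b' S T hST N hN) = N := by
  ext : 1
  rw [splitPrecomp_toSubmodule, splitPostcomp_toSubmodule, comap_map_eq_of_ker_le b b' S _ hN]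

/-- **`S(S⁻¹N') = N'`** (`S` is surjective). [cite: GortzWedhorn2020, Prop. 8.17 (2)] -/
theorem splitPostcomp_splitPrecomp (N' : Module.Grassmannian A (A ⊗[R] M') k) :
    splitPostcomp b b' S T hST (splitPrecomp b b' S T hST N') (ker_matLinMap_le_splitPrecomp b b' S T hST N') = N' := by
  ext : 1
  rw [splitPostcomp_toSubmodule, splitPrecomp_toSubmodule,
    Submodule.map_comap_eq_of_surjective (matLinMap_surjective_of_mul_eq_one b b' hST)]

/-- **THE IMAGE OF `N' ↦ S⁻¹N'`**: a point `N ∈ G(k, A ⊗ M; A)` is of the form `S⁻¹N'` iff `ker S ≤ N` — the `A`-points of the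
closed sub-Grassmannian `Grass(A ⊗ M') ↪ Grass(A ⊗ M)` of the split surjection `S`. [cite: GortzWedhorn2020, Prop. 8.17 (2)]
[cite: StacksProject, Tag 089R] -/
theorem exists_eq_splitPrecomp_iff (N : Module.Grassmannian A (A ⊗[R] M) k) :
    (∃ N' : Module.Grassmannian A (A ⊗[R] M') k, splitPrecomp b b' S T hST N' = N) ↔
      LinearMap.ker (matLinMap b b' S) ≤ N.toSubmodule := by
  constructor
  · rintro ⟨N', rfl⟩
    exact ker_matLinMap_le_splitPrecomp b b' S T hST N'
  · intro hN
    exact ⟨splitPostcomp b b' S T hST N hN, splitPrecomp_splitPostcomp b b' S T hST N hN⟩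

omit hST in
/-- **Naturality of `N ↦ S N` in the ring** (transported from `map_splitPrecomp` by injectivity of `S⁻¹`).
[cite: GortzWedhorn2020, Prop. 8.17 (2)] -/
theorem map_splitPostcomp (f : A →ₐ[R] B) (hST : S * T = 1) (hST' : S.map f * T.map f = 1)
    (N : Module.Grassmannian A (A ⊗[R] M) k) (hN : LinearMap.ker (matLinMap b b' S) ≤ N.toSubmodule)
    (hN' : LinearMap.ker (matLinMap b b' (S.map f)) ≤ (Module.Grassmannian.map f N).toSubmodule) :
    Module.Grassmannian.map f (splitPostcomp b b' S T hST N hN) =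
      splitPostcomp b b' (S.map f) (T.map f) hST' (Module.Grassmannian.map f N) hN' := by
  apply splitPrecomp_injective b b' (S.map f) (T.map f) hST'
  rw [splitPrecomp_splitPostcomp, ← map_splitPrecomp b b' S T f hST hST', splitPrecomp_splitPostcomp]

end Split

end Grassmannian

end Literature.AlgebraicGeometry.Motives

end
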